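import Summits.CriticalPhenomena.SAWScalingLimit.Theses.SAWDimerizationRG
import Literature.Probability.RandomPlanarGeometry.UniformSAWCurveLaw
import HarnessLib.Audit

/-!
# Crux `CanonicalLimit` (stmt-CriticalPhenomena-10693) — birth skeleton `Lines/birth.lean`

Route `SAWDimerizationRG` (route-CriticalPhenomena-SAWDimerizationRG, rank 2, "(E) orbit convergence"),
sub-problem `SAWScalingLimit`. Crux, concluded BY NAME:
`Summit.CriticalPhenomena.SAWScalingLimit.Theses.SAWDimerizationRG.CanonicalLimit` — there are a deterministic
normalisation `r_n > 0` and a probability law `P` on `CurveClass ℂ` with `P(constant curve) = 0` such that the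
uniform `n`-step self-avoiding walk from `0` on `ℤ²`, drawn at mesh `1/r_n`, converges in law to `P` as `n → ∞`
(all bounded continuous test functions, all `n`). By `canonicalLimit_iff` below (`Iff.rfl`) the inlined measure of
the route decl is `SAW.Zd.uniformSAWCurveLaw n (r n)⁻¹` (`UniformSAWCurveLaw.lean`, the definition file the route
requested; statement cone unchanged).

## The line (Prokhorov/Billingsley architecture at the INTRINSIC r.m.s. scale — the route's own foreseen split
"CanonicalLimit ⇐ CanonicalTight (tightness + no atom at the constant curve for r_n := RMS end-to-end distance) →
UniqueClusterPoint")

Fix the normalisation once and for all to the root-mean-square end-to-end distance of the uniform `n`-step SAW,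
`ρ_n := max 1 √(c_n⁻¹ Σ_{ω ∈ saws 2 n} |ω(n)|²)` (the floor `1` is inactive for `n ≥ 1`, where every walk ends at
a lattice point `≠ 0`; it only makes `ρ_0 = 1 > 0`), and let `U_n := uniformSAWCurveLaw n ρ_n⁻¹` be the canonical
law drawn at mesh `1/ρ_n` (so `E_{U_n} |endpoint|² = 1` exactly for `n ≥ 1`). Convergence of `(U_n)` in law ⇐
(T) the family `{U_n}` is TIGHT on the Polish space `CurveClass ℂ` + (N) NO COLLAPSE: every weak subsequential
limit gives mass `0` to the constant curve + (U) UNIQUENESS: any two non-degenerate weak subsequential limits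
coincide. The scale must be intrinsic: over an ARBITRARY normalisation `r_n` uniqueness of cluster points is
false for trivial reasons (`r_n = 2^{(-1)^n} ρ_n` has the two dilates of any limit as cluster points), which is
why (N) and (U) are stated at `ρ_n` and the `∃ r` of the crux is witnessed by `r := ρ`. This is literally the
architecture of the one proved instance of the statement, `d ≥ 5` (Madras–Slade 1993 Thm 6.1.8, pdf p. 187:
`X_n(k/n) = (Dn)^{-1/2} ω(k)` converges in distribution to Brownian motion — tightness + identification of the
limit, Hara–Slade), transported to `d = 2` where all three inputs are open.

Three registered stubs, each a genuine lemma stated over tree declarations (`SAW.Zd.uniformSAWCurveLaw`,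
`SAW.Zd.saws`, `SAW.Zd.normSq`, Mathlib's `IsTightMeasureSet`, `CurveClass.rangeSubset`):

* `stub_canonicalTight` (T) — `IsTightMeasureSet {U_n : n ∈ ℕ}`. OPEN, size XL: needs an annulus-crossing /
  tortuosity bound for the whole-plane fixed-length walk at its own scale (Aizenman–Burchard Thm 1.1–1.2,
  Kemppainen–Smirnov Thm 1.5 type hypothesis) AND "no mass escape" `P(diam ω > K ρ_n) → 0` uniformly in `n`
  (comparability of `max_k |ω(k)|` and `|ω(n)|` in law — unproved in `d = 2`; BDGS2012 §1.5.2: even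
  `c n ≤ E|ω(n)|² ≤ C n^{2-ε}` is open). No junk-value artefact of the kind that killed the all-`δ` chordal
  tightness stmt-0772 (`SAWParafermionTight_refuted`): the index is `ℕ`, every walk starts at `0`, each `U_n` is
  finitely supported, so tightness of the whole range is tightness of the tail.
* `stub_noCollapse` (N) — every probability weak limit `P` of `(U_{φ k})`, `φ` strictly increasing, has
  `P (rangeSubset {0}) = 0`. OPEN, size L–XL: anti-concentration of `|ω(n)|/ρ_n` at `0` (equivalently of the
  diameter), i.e. the end-to-end law at its r.m.s. scale has no atom at `0` in the limit; predicted by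
  hyperscaling for `c_N(0,x)` (Madras–Slade (1.4.13)–(1.4.14), `α_sing - 2 = -dν`: endpoints near the origin are
  suppressed, scaling density `∝ |u|^{(γ-1)/ν}` at `0`, `γ = 43/32` by LSW04 Prediction 5), rigorously open (only a
  `ν ∈ [2/3, 1]`-type window: DuminilCopinHammond2013, arXiv:2310.17299).
* `stub_uniqueClusterPoint` (U) — two probability measures, both charging the constant curve with mass `0`, both
  weak limits of `(U_n)` along strictly increasing subsequences, are equal. OPEN, size XL — the core of the crux
  and the place where the route's mechanism is meant to act: the exact dimerization identity
  `U_{m+n} = (U_m ⊗ U_n ∣ avoid)` (`SAW.Zd.uniformSAWCurveLaw_add_eq_sum_avoidingPairs`, `bijOn_concatWalk`) makes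
  every cluster law a fixed point of the fusion map along its own subsequence; uniqueness of the fixed point
  (FusionRigidity, item stmt-6821, informal) would identify all cluster laws. LSW04 §4.3 Predictions 7–8.

`CanonicalLimit_of : Stubs.stub_canonicalTight → Stubs.stub_noCollapse → Stubs.stub_uniqueClusterPoint →
CanonicalLimit` is PROVED below (no `sorry`; ~40 lines): package `U_n` as points of
`ProbabilityMeasure (CurveClass ℂ)`; Prokhorov (`isCompact_closure_of_isTightMeasureSet`, Mathlib) + Lévy–Prokhorov
metrisability give, from (T), a weakly convergent sub-subsequence of every subsequence
(`IsCompact.tendsto_subseq`, `ProbabilityMeasure.tendsto_iff_forall_integral_tendsto`); the limit along the full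
sequence's subsequence is the candidate `P`, non-degenerate by (N); every other sub-subsequential limit is
non-degenerate by (N) and equals `P` by (U); `Filter.tendsto_of_subseq_tendsto` +
`Filter.strictMono_subseq_of_tendsto_atTop` conclude, with `r := ρ` (`rmsScale_pos`) and the `Iff.rfl` bridge
`canonicalLimit_iff` (Billingsley 1999, Thm 5.1 and its Corollary).

Sorries: exactly 3 = the three `stub_*` theorems; zero elsewhere. Disproof used: none relevant — no
`Cruxes/CanonicalLimit/Disproof.lean` exists at registration (`ledger crux ls stmt-CriticalPhenomena-10693`: no
workfiles). Negatives honoured (`ledger negatives --problem CriticalPhenomena`, 11 entries): none concerns the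
canonical whole-plane ensemble; the all-`δ` tightness twist of stmt-0772 does not transfer (see (T)). BC3 probes
(planner folder `bc/probe_*.lean`, `first | exact? | simpa [S] | (unfold S; simpa) | aesop`, maxHeartbeats 400000):
for each of the 3 stubs, `stub → CanonicalLimit` and `stub → SAWScalingLimit` FAIL (6/6).
-/

noncomputable section

open MeasureTheory Filter Topology Set
open scoped NNReal ENNReal BoundedContinuousFunction
open Literature.Probability.RandomPlanarGeometry Literature.Probability.LatticeModels

namespace Summit.CriticalPhenomena.SAWScalingLimit.Cruxes.CanonicalLimit.Birth

/-! ## The three registered stubs: precise `Prop`s `Stubs.stub_*` (hypotheses of `CanonicalLimit_of` BY NAME)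
+ the sorried theorems `stub_*` with the same statements spelled out over tree declarations -/

namespace Stubs

/-- **Stub `Prop` (T) `canonicalTight`** — the uniform `n`-step SAW laws drawn at the r.m.s. end-to-end scale,
`n ∈ ℕ`, form a tight set of measures on `CurveClass ℂ`. -/
def stub_canonicalTight : Prop :=
  MeasureTheory.IsTightMeasureSet (Set.range fun n : ℕ => Literature.Probability.RandomPlanarGeometry.SAW.Zd.uniformSAWCurveLaw n (max 1 (Real.sqrt (((Literature.Probability.RandomPlanarGeometry.SAW.Zd.saws 2 n).card : ℝ)⁻¹ * ∑ ω ∈ Literature.Probability.RandomPlanarGeometry.SAW.Zd.saws 2 n, Literature.Probability.RandomPlanarGeometry.SAW.Zd.normSq (ω n))))⁻¹)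

/-- **Stub `Prop` (N) `noCollapse`** — no weak subsequential limit at the r.m.s. scale charges the constant curve. -/
def stub_noCollapse : Prop :=
  ∀ (P : MeasureTheory.Measure (Literature.Probability.RandomPlanarGeometry.CurveClass ℂ)), MeasureTheory.IsProbabilityMeasure P → (∃ φ : ℕ → ℕ, StrictMono φ ∧ ∀ f : BoundedContinuousFunction (Literature.Probability.RandomPlanarGeometry.CurveClass ℂ) ℝ, Filter.Tendsto (fun k : ℕ => ∫ c, f c ∂(Literature.Probability.RandomPlanarGeometry.SAW.Zd.uniformSAWCurveLaw (φ k) (max 1 (Real.sqrt (((Literature.Probability.RandomPlanarGeometry.SAW.Zd.saws 2 (φ k)).card : ℝ)⁻¹ * ∑ ω ∈ Literature.Probability.RandomPlanarGeometry.SAW.Zd.saws 2 (φ k), Literature.Probability.RandomPlanarGeometry.SAW.Zd.normSq (ω (φ k)))))⁻¹)) Filter.atTop (nhds (∫ c, f c ∂P))) → P (Literature.Probability.RandomPlanarGeometry.CurveClass.rangeSubset {0}) = 0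

/-- **Stub `Prop` (U) `uniqueClusterPoint`** — two non-degenerate weak subsequential limits at the r.m.s. scale
coincide. -/
def stub_uniqueClusterPoint : Prop :=
  ∀ (P P' : MeasureTheory.Measure (Literature.Probability.RandomPlanarGeometry.CurveClass ℂ)), MeasureTheory.IsProbabilityMeasure P → MeasureTheory.IsProbabilityMeasure P' → P (Literature.Probability.RandomPlanarGeometry.CurveClass.rangeSubset {0}) = 0 → P' (Literature.Probability.RandomPlanarGeometry.CurveClass.rangeSubset {0}) = 0 → (∃ φ : ℕ → ℕ, StrictMono φ ∧ ∀ f : BoundedContinuousFunction (Literature.Probability.RandomPlanarGeometry.CurveClass ℂ) ℝ, Filter.Tendsto (fun k : ℕ => ∫ c, f c ∂(Literature.Probability.RandomPlanarGeometry.SAW.Zd.uniformSAWCurveLaw (φ k) (max 1 (Real.sqrt (((Literature.Probability.RandomPlanarGeometry.SAW.Zd.saws 2 (φ k)).card : ℝ)⁻¹ * ∑ ω ∈ Literature.Probability.RandomPlanarGeometry.SAW.Zd.saws 2 (φ k), Literature.Probability.RandomPlanarGeometry.SAW.Zd.normSq (ω (φ k)))))⁻¹)) Filter.atTop (nhds (∫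 c, f c ∂P))) → (∃ φ : ℕ → ℕ, StrictMono φ ∧ ∀ f : BoundedContinuousFunction (Literature.Probability.RandomPlanarGeometry.CurveClass ℂ) ℝ, Filter.Tendsto (fun k : ℕ => ∫ c, f c ∂(Literature.Probability.RandomPlanarGeometry.SAW.Zd.uniformSAWCurveLaw (φ k) (max 1 (Real.sqrt (((Literature.Probability.RandomPlanarGeometry.SAW.Zd.saws 2 (φ k)).card : ℝ)⁻¹ * ∑ ω ∈ Literature.Probability.RandomPlanarGeometry.SAW.Zd.saws 2 (φ k), Literature.Probability.RandomPlanarGeometry.SAW.Zd.normSq (ω (φ k)))))⁻¹)) Filter.atTop (nhds (∫ c, f c ∂P'))) → P = P'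

end Stubs

/-- **Stub (T) — TIGHTNESS AT THE R.M.S. SCALE** (OPEN, size XL): the set `{U_n : n ∈ ℕ}` of uniform `n`-step
SAW laws on `ℤ²` from `0`, each drawn at mesh `1 / max 1 √(c_n⁻¹ Σ_ω |ω(n)|²)`, is a tight set of measures on
`CurveClass ℂ` (Mathlib `IsTightMeasureSet`). Needs a whole-plane annulus-crossing bound for the fixed-length
walk (curve regularity modulo reparametrisation) and no escape of mass at scale `ρ_n` (`diam ω / ρ_n` tight);
neither is in print for `d = 2` (proved for `d ≥ 5`, where the same statement holds at scale `(Dn)^{1/2}`).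
[cite: AizenmanBurchardDuke1999, Thm 1.1–1.2] [cite: KemppainenSmirnov2017, Thm 1.5]
[cite: MadrasSlade1993, Thm 6.1.8] [cite: BDGS2012, §1.5.2] -/
theorem stub_canonicalTight : MeasureTheory.IsTightMeasureSet (Set.range fun n : ℕ => Literature.Probability.RandomPlanarGeometry.SAW.Zd.uniformSAWCurveLaw n (max 1 (Real.sqrt (((Literature.Probability.RandomPlanarGeometry.SAW.Zd.saws 2 n).card : ℝ)⁻¹ * ∑ ω ∈ Literature.Probability.RandomPlanarGeometry.SAW.Zd.saws 2 n, Literature.Probability.RandomPlanarGeometry.SAW.Zd.normSq (ω n))))⁻¹) := by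
  sorry

/-- **Stub (N) — NO COLLAPSE AT THE R.M.S. SCALE** (OPEN, size L–XL): every probability measure `P` that is a
weak limit (all bounded continuous test functions) of `U_{φ k}` along a strictly increasing `φ` gives mass `0` to
the event `rangeSubset {0}` (the constant curve at the origin — every `U_n`-curve starts at `0`). Equivalently:
`|ω(n)| / ρ_n` (or `diam ω / ρ_n`) does not concentrate at `0` along any subsequence although its second moment
is pinned to `1`; predicted by hyperscaling for the endpoint counts `c_N(0,x)` (endpoints near the origin are
suppressed), rigorously open in `d = 2`.
[cite: MadrasSlade1993, §1.4 eqs. (1.4.13)–(1.4.14)] [cite: LawlerSchrammWerner2004SAW, §4.2 Prediction 5]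
[cite: DuminilCopinHammond2013, Thm 1.1] [cite: BDGS2012, §1.5.2] -/
theorem stub_noCollapse : ∀ (P : MeasureTheory.Measure (Literature.Probability.RandomPlanarGeometry.CurveClass ℂ)), MeasureTheory.IsProbabilityMeasure P → (∃ φ : ℕ → ℕ, StrictMono φ ∧ ∀ f : BoundedContinuousFunction (Literature.Probability.RandomPlanarGeometry.CurveClass ℂ) ℝ, Filter.Tendsto (fun k : ℕ => ∫ c, f c ∂(Literature.Probability.RandomPlanarGeometry.SAW.Zd.uniformSAWCurveLaw (φ k) (max 1 (Real.sqrt (((Literature.Probability.RandomPlanarGeometry.SAW.Zd.saws 2 (φ k)).card : ℝ)⁻¹ * ∑ ω ∈ Literature.Probability.RandomPlanarGeometry.SAW.Zd.saws 2 (φ k), Literature.Probability.RandomPlanarGeometry.SAW.Zd.normSq (ω (φ k)))))⁻¹)) Filter.atTop (nhds (∫ c, f c ∂P))) → P (Literature.Probability.RandomPlanarGeometry.CurveClass.rangeSubset {0}) = 0 := by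
  sorry

/-- **Stub (U) — UNIQUENESS OF THE NON-DEGENERATE CLUSTER LAW** (OPEN, size XL; the load-bearing stub): two
probability measures on `CurveClass ℂ`, both charging the constant curve with mass `0`, both weak limits of the
r.m.s.-scaled uniform SAW laws along strictly increasing subsequences, are equal. This is where the route's exact
dimerization identity `U_{m+n} = (U_m ⊗ U_n ∣ avoid)` (`uniformSAWCurveLaw_add_eq_sum_avoidingPairs`) is meant to
bite: every cluster law is a fixed point of the (space-rescaled) fusion map along its subsequence, and rigidity of
that fixed point (item FusionRigidity, stmt-CriticalPhenomena-6821) identifies them. Stated at the intrinsic scale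
on purpose (over a free normalisation it is false by dilation).
[cite: LawlerSchrammWerner2004SAW, §4.3 Predictions 7–8] [cite: MadrasSlade1993, Lemma 9.3.1] -/
theorem stub_uniqueClusterPoint : ∀ (P P' : MeasureTheory.Measure (Literature.Probability.RandomPlanarGeometry.CurveClass ℂ)), MeasureTheory.IsProbabilityMeasure P → MeasureTheory.IsProbabilityMeasure P' → P (Literature.Probability.RandomPlanarGeometry.CurveClass.rangeSubset {0}) = 0 → P' (Literature.Probability.RandomPlanarGeometry.CurveClass.rangeSubset {0}) = 0 → (∃ φ : ℕ → ℕ, StrictMono φ ∧ ∀ f : BoundedContinuousFunction (Literature.Probability.RandomPlanarGeometry.CurveClass ℂ) ℝ, Filter.Tendsto (fun k : ℕ => ∫ c, f c ∂(Literature.Probability.RandomPlanarGeometry.SAW.Zd.uniformSAWCurveLaw (φ k) (max 1 (Real.sqrt (((Literature.Probability.RandomPlanarGeometry.SAW.Zd.saws 2 (φ k)).card : ℝ)⁻¹ * ∑ ω ∈ Literature.Probability.RandomPlanarGeometry.SAW.Zd.saws 2 (φ k), Literature.Probability.RandomPlanarGeometry.SAW.Zd.normSq (ω (φ k)))))⁻¹))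 Filter.atTop (nhds (∫ c, f c ∂P))) → (∃ φ : ℕ → ℕ, StrictMono φ ∧ ∀ f : BoundedContinuousFunction (Literature.Probability.RandomPlanarGeometry.CurveClass ℂ) ℝ, Filter.Tendsto (fun k : ℕ => ∫ c, f c ∂(Literature.Probability.RandomPlanarGeometry.SAW.Zd.uniformSAWCurveLaw (φ k) (max 1 (Real.sqrt (((Literature.Probability.RandomPlanarGeometry.SAW.Zd.saws 2 (φ k)).card : ℝ)⁻¹ * ∑ ω ∈ Literature.Probability.RandomPlanarGeometry.SAW.Zd.saws 2 (φ k), Literature.Probability.RandomPlanarGeometry.SAW.Zd.normSq (ω (φ k)))))⁻¹)) Filter.atTop (nhds (∫ c, f c ∂P'))) → P = P' := by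
  sorry

/-! Consistency: each registered theorem statement IS the corresponding `Stubs` `Prop` (definitional). -/

example : Stubs.stub_canonicalTight := stub_canonicalTight
example : Stubs.stub_noCollapse := stub_noCollapse
example : Stubs.stub_uniqueClusterPoint := stub_uniqueClusterPoint

/-! ## Readable forms: the r.m.s. scale `ρ_n` and the canonical law `U_n` at that scale -/

/-- The normalisation `ρ_n := max 1 √(c_n⁻¹ Σ_{ω ∈ saws 2 n} |ω(n)|²)`: the root-mean-square end-to-end distance of
the uniform `n`-step SAW (Madras–Slade (1.1.2)), floored at `1` (inactive for `n ≥ 1`; makes `ρ_0 = 1`).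
[cite: MadrasSlade1993, §1.1 eq. (1.1.2)] -/
def rmsScale (n : ℕ) : ℝ :=
  max 1 (Real.sqrt (((SAW.Zd.saws 2 n).card : ℝ)⁻¹ * ∑ ω ∈ SAW.Zd.saws 2 n, SAW.Zd.normSq (ω n)))

/-- `U_n`: the uniform `n`-step SAW from `0` on `ℤ²` drawn at mesh `1 / ρ_n`. [cite: MadrasSlade1993, §1.1] -/
def canonicalLaw (n : ℕ) : Measure (CurveClass ℂ) :=
  SAW.Zd.uniformSAWCurveLaw n (rmsScale n)⁻¹

/-- `ρ_n > 0` (the witness for the clause `∀ n, 0 < r n` of the crux). [folklore] -/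
theorem rmsScale_pos (n : ℕ) : 0 < rmsScale n := lt_max_of_lt_left one_pos

/-- `U_n` is a probability measure (`c_n ≥ 1`). [cite: MadrasSlade1993, §1.1] -/
instance isProbabilityMeasure_canonicalLaw (n : ℕ) : IsProbabilityMeasure (canonicalLaw n) :=
  SAW.Zd.isProbabilityMeasure_uniformSAWCurveLaw n _

/-- (T) in readable form (definitional). [folklore] -/
theorem tight_iff :
    Stubs.stub_canonicalTight ↔ IsTightMeasureSet (Set.range canonicalLaw) := Iff.rfl

/-- (N) in readable form (definitional). [folklore] -/
theorem noCollapse_iff :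
    Stubs.stub_noCollapse ↔ ∀ P : Measure (CurveClass ℂ), IsProbabilityMeasure P →
      (∃ φ : ℕ → ℕ, StrictMono φ ∧ ∀ f : CurveClass ℂ →ᵇ ℝ,
        Tendsto (fun k : ℕ => ∫ c, f c ∂(canonicalLaw (φ k))) atTop (𝓝 (∫ c, f c ∂P))) →
      P (CurveClass.rangeSubset {0}) = 0 := Iff.rfl

/-- (U) in readable form (definitional). [folklore] -/
theorem unique_iff :
    Stubs.stub_uniqueClusterPoint ↔ ∀ P P' : Measure (CurveClass ℂ), IsProbabilityMeasure P →
      IsProbabilityMeasure P' → P (CurveClass.rangeSubset {0}) = 0 → P' (CurveClass.rangeSubset {0}) = 0 →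
      (∃ φ : ℕ → ℕ, StrictMono φ ∧ ∀ f : CurveClass ℂ →ᵇ ℝ,
        Tendsto (fun k : ℕ => ∫ c, f c ∂(canonicalLaw (φ k))) atTop (𝓝 (∫ c, f c ∂P))) →
      (∃ φ : ℕ → ℕ, StrictMono φ ∧ ∀ f : CurveClass ℂ →ᵇ ℝ,
        Tendsto (fun k : ℕ => ∫ c, f c ∂(canonicalLaw (φ k))) atTop (𝓝 (∫ c, f c ∂P'))) →
      P = P' := Iff.rfl

/-- The crux with the inlined measure recognised as the library law `uniformSAWCurveLaw n (r n)⁻¹` — definitional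
(`Iff.rfl`), as recorded on the item (route rev 1; refuter/grounder certificates). [folklore] -/
theorem canonicalLimit_iff :
    Summit.CriticalPhenomena.SAWScalingLimit.Theses.SAWDimerizationRG.CanonicalLimit ↔
      ∃ (r : ℕ → ℝ) (P : Measure (CurveClass ℂ)), (∀ n, 0 < r n) ∧ IsProbabilityMeasure P ∧
        P (CurveClass.rangeSubset {0}) = 0 ∧ ∀ f : CurveClass ℂ →ᵇ ℝ,
          Tendsto (fun n : ℕ => ∫ c, f c ∂(SAW.Zd.uniformSAWCurveLaw n (r n)⁻¹)) atTop (𝓝 (∫ c, f c ∂P)) :=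
  Iff.rfl

/-! ## The composition: (T), (N), (U) imply the crux BY NAME (kernel-checked, no `sorry`) -/

/-- **`CanonicalLimit` from (T), (N), (U)** — Prokhorov + the subsequence principle at the r.m.s. scale
(Billingsley, *Convergence of Probability Measures*, Thm 5.1 and Corollary): by (T) and Prokhorov's theorem
(`isCompact_closure_of_isTightMeasureSet`) the laws `U_n` lie in a compact, metrisable (Lévy–Prokhorov) subset of
`ProbabilityMeasure (CurveClass ℂ)`, so every subsequence has a weakly convergent sub-subsequence; the limit `P`
along the full sequence is non-degenerate by (N); any other sub-subsequential limit is non-degenerate by (N) and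
equals `P` by (U); `tendsto_of_subseq_tendsto` gives `U_n → P`, and `r := ρ` witnesses the crux.
[cite: BillingsleyCPM1999, Thm 5.1 and Corollary] -/
theorem CanonicalLimit_of :
    Stubs.stub_canonicalTight → Stubs.stub_noCollapse → Stubs.stub_uniqueClusterPoint →
      Summit.CriticalPhenomena.SAWScalingLimit.Theses.SAWDimerizationRG.CanonicalLimit := by
  intro hT hN hU
  rw [tight_iff] at hT
  rw [noCollapse_iff] at hN
  rw [unique_iff] at hU
  -- the canonical laws as points of the space of probability measures (topology of weak convergence)
  let μ : ℕ → ProbabilityMeasure (CurveClass ℂ) := fun n => ⟨canonicalLaw n, inferInstance⟩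
  have hμ : ∀ n, ((μ n : ProbabilityMeasure (CurveClass ℂ)) : Measure (CurveClass ℂ)) = canonicalLaw n :=
    fun n => rfl
  -- Prokhorov: a tight family of probability laws (on the Polish space `CurveClass ℂ`) has compact closure
  have hK : IsCompact (closure (Set.range μ)) := by
    refine isCompact_closure_of_isTightMeasureSet (hT.subset ?_)
    rintro _ ⟨ν, ⟨n, rfl⟩, rfl⟩
    exact ⟨n, rfl⟩
  -- weak convergence along a subsequence, in the test-function form of the stubs
  have integral_form : ∀ (θ : ℕ → ℕ) (Q : ProbabilityMeasure (CurveClass ℂ)),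
      Tendsto (μ ∘ θ) atTop (𝓝 Q) → ∀ f : CurveClass ℂ →ᵇ ℝ,
        Tendsto (fun k : ℕ => ∫ c, f c ∂(canonicalLaw (θ k))) atTop
          (𝓝 (∫ c, f c ∂(Q : Measure (CurveClass ℂ)))) := by
    intro θ Q h f
    have := (ProbabilityMeasure.tendsto_iff_forall_integral_tendsto.1 h) f
    simpa [Function.comp_def, hμ] using this
  -- every strictly increasing sequence of times has a subsequence along which the laws converge weakly
  -- (Lévy–Prokhorov metrisability ⇒ sequential compactness of the compact closure) to a probability law,
  -- which is then a CLUSTER LAW in the sense of the stubs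
  have key : ∀ φ : ℕ → ℕ, StrictMono φ → ∃ ψ : ℕ → ℕ, StrictMono ψ ∧
      ∃ Q : ProbabilityMeasure (CurveClass ℂ),
        (∃ χ : ℕ → ℕ, StrictMono χ ∧ ∀ f : CurveClass ℂ →ᵇ ℝ,
          Tendsto (fun k : ℕ => ∫ c, f c ∂(canonicalLaw (χ k))) atTop
            (𝓝 (∫ c, f c ∂(Q : Measure (CurveClass ℂ))))) ∧
        ∀ f : CurveClass ℂ →ᵇ ℝ, Tendsto (fun k : ℕ => ∫ c, f c ∂(canonicalLaw (φ (ψ k)))) atTop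
          (𝓝 (∫ c, f c ∂(Q : Measure (CurveClass ℂ)))) := by
    intro φ hφ
    obtain ⟨Q, -, ψ, hψ, hconv⟩ := hK.tendsto_subseq (x := μ ∘ φ) fun n => subset_closure ⟨φ n, rfl⟩
    have hint := integral_form (φ ∘ ψ) Q (by simpa [Function.comp_def] using hconv)
    exact ⟨ψ, hψ, Q, ⟨φ ∘ ψ, hφ.comp hψ, hint⟩, hint⟩
  -- the candidate limit: a cluster law along the full sequence; it does not charge the constant curve (N)
  obtain ⟨ψ₀, hψ₀, Q₀, hQ₀cl, hQ₀⟩ := key id strictMono_id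
  have hQ₀N : (Q₀ : Measure (CurveClass ℂ)) (CurveClass.rangeSubset {0}) = 0 := hN _ inferInstance hQ₀cl
  rw [canonicalLimit_iff]
  refine ⟨rmsScale, (Q₀ : Measure (CurveClass ℂ)), rmsScale_pos, inferInstance, hQ₀N, fun f => ?_⟩
  -- subsequence principle: every subsequence has a further subsequence converging to a non-degenerate
  -- cluster law (N), which is `Q₀` by uniqueness (U)
  change Tendsto (fun n : ℕ => ∫ c, f c ∂(canonicalLaw n)) atTop (𝓝 (∫ c, f c ∂(Q₀ : Measure (CurveClass ℂ))))
  refine tendsto_of_subseq_tendsto fun ns hns => ?_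
  obtain ⟨φ, -, hmono⟩ := strictMono_subseq_of_tendsto_atTop hns
  obtain ⟨ψ, hψ, Q, hQcl, hQ⟩ := key (ns ∘ φ) hmono
  have hQN : (Q : Measure (CurveClass ℂ)) (CurveClass.rangeSubset {0}) = 0 := hN _ inferInstance hQcl
  have hQQ : (Q₀ : Measure (CurveClass ℂ)) = Q := hU _ _ inferInstance inferInstance hQ₀N hQN hQ₀cl hQcl
  refine ⟨φ ∘ ψ, ?_⟩
  rw [hQQ]
  simpa [Function.comp_def] using hQ f

/-- Wiring check: the crux BY NAME from the three registered (sorried) stubs — the stub theorems are exactly the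
hypotheses of `CanonicalLimit_of` (inherits their `sorry`; nothing is claimed). -/
example : Summit.CriticalPhenomena.SAWScalingLimit.Theses.SAWDimerizationRG.CanonicalLimit :=
  CanonicalLimit_of stub_canonicalTight stub_noCollapse stub_uniqueClusterPoint

end Summit.CriticalPhenomena.SAWScalingLimit.Cruxes.CanonicalLimit.Birth

end
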